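import Literature.Probability.Percolation.PositiveAssociation
import HarnessLib

/-!
# Williams (2025), Theorem 3: three increasing events of equal probability `ρ` are "exactly one" with
# probability at most `3ρ(1−ρ)/(1+ρ)`

CITATION HEADER.  Source: K. Williams, *A Correlation Inequality on Three Functions*, arXiv:2502.14857 (2025)
[WilliamsKK2025], pp. 1–3, read from the materialised arXiv text.  Verbatim (p. 2): "It is therefore natural
to explore the set of points in exactly one of the three systems,
`S_1 = (X ∩ Y^c ∩ Z^c) ⊔ (X^c ∩ Y ∩ Z^c) ⊔ (X^c ∩ Y^c ∩ Z)`. … **Theorem 3.** Let `|X| = |Y| = |Z| = ρ · 2^n`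
[`X, Y, Z ⊂ Q_n` upward closed]. Then `|S_1|/2^n ≤ 3ρ · (1−ρ)/(1+ρ)`."  Proof (p. 3, verbatim): "For each
`i = 0,1,2,3`, let `s_i · 2^n` be the number of sets in `Q_n` that occur in `i` many of `{X, Y, Z}` …
Theorem 1 [Harris–Kleitman] implies that `|X ∩ Y ∩ Z| ≥ ρ|X ∩ Y|`, and similarly for `Y ∩ Z` and `Z ∩ X`.
Adding these up yields `3(1 − ρ)s_3 ≥ ρ s_2`, where `s_2 ≥ 0`.  The same argument for the complements informs us
that `3ρ s_0 ≥ (1 − ρ)s_1`, where `s_1 ≥ 0`.  Finally, the constraint on the size of `X, Y`, and `Z` implies that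
`s_1 + 2s_2 + 3s_3 = 3ρ`. … Solving the linear system, we obtain `s_1 ≤ 3(1−ρ)ρ/(1+ρ)`."  (Context, p. 2:
"**Conjecture 4 (Kahn).** If `|X| = |Y| = |Z|`, then `|S_1|/2^n ≤ 4/9`" — REFUTED in §4 of the paper by a
counterexample in `Q_21` pulled back from the weighted cube `Q_7(3/8)`; that computation is not reproduced here.)

What is here (PROVED; no definition, no named fact).  The printed proof uses only the Harris–Kleitman inequality,
so the theorem is stated for every POSITIVELY ASSOCIATED probability measure on a preordered measurable space
(`Literature.Probability.Percolation.IsPositivelyAssociated`; the uniform measure on `Q_n`, every product measure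
and every FKG measure are instances) and three increasing measurable events of common probability `ρ`:
* `williams2025_thm3_mul` — `(1 + ρ) · P(S_1) ≤ 3ρ(1 − ρ)`, with
  `P(S_1) = P(X ∖ (Y ∪ Z)) + P(Y ∖ (X ∪ Z)) + P(Z ∖ (X ∪ Y))`;
* **`williams2025_thm3`** — `P(S_1) ≤ 3ρ(1 − ρ)/(1 + ρ)` as printed.
The proof is the printed linear-programming argument, of which only the complement half
(`3ρ s_0 ≥ (1−ρ) s_1`, i.e. Harris for `X ∪ Y` against `Z` etc. read through inclusion–exclusion) and `s_2 ≥ 0`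
are actually needed.
Also here (PROVED by `decide`, §2 of the paper): **Conjecture 2 is false for `n = 5`** — the printed up-sets
`X, Y, Z ⊂ Q_5` of density `1/2` (`Williams2025.X5`, `Y5`, `Z5`) have `|S_1| = 13 > 12 = 3ρ(1−ρ)² · 2^5`, so the
value `3ρ(1−ρ)²` attained by three independent up-sets is NOT an upper bound (`Williams2025.card_exactlyOne`,
`williams2025_conjecture2_false`).  Verbatim (p. 2): "**Conjecture 2.** Let `X, Y, Z ⊂ Q_n` be upward closed set
systems of density `ρ`. Then `|S_1|/2^n ≤ 3ρ(1−ρ)²`.  While this conjecture is false for `n = 5` … In `Q_5`, let `X`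
and `Y` contain the sets that have `1` and `2` as an element, respectively. To begin with, let `W` contain the sets
with at least `3` elements in `[5]`. … This can be improved by introducing the sets `{3,4}` and `{3,5}` into `W`,
removing the sets `{1,4,5}` and `{2,4,5}` in return. The resulting set system `Z` is upward closed … Thus,
`|S_1| = 5 + 5 + 3 = 13`, which is larger than `4/9 · 2^5 = 12`" [sic — a misprint in arXiv v2, confirmed on the PDF: the
intended value is the Conjecture-2 bound `3ρ(1−ρ)² · 2^5 = (3/8) · 32 = 12`, while `(4/9) · 2^5 ≈ 14.2 > 13`; the `Q_5` example refutes Conjecture 2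
only, not Kahn's `4/9`].  (Vertices are `0`-indexed below: `1 ↦ 0, …, 5 ↦ 4`.)
-- TODO(general form): the optimality discussion (weighted poset `P = {a, A, p_1, p_2, p_3}`, p. 3) and the `Q_21`
-- counterexample to Kahn's `4/9` conjecture (§4) are not formalised.

## References
* K. Williams, *A Correlation Inequality on Three Functions*, arXiv:2502.14857 (2025), Theorem 3 (p. 2) and §3;
  Conjecture 2 and §2 "Proof that Conjecture 2 is false" (p. 2). [WilliamsKK2025]
-/

noncomputable section

open MeasureTheory Measure Set

namespace Literature.Probability.LatticeModels

open Literature.Probability.Percolation (IsPositivelyAssociated)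

variable {Ω : Type*} [MeasurableSpace Ω] [Preorder Ω]

/-- **Williams 2025, Theorem 3 (division-free form), for any positively associated probability measure**: if
`X, Y, Z` are increasing measurable events with `P(X) = P(Y) = P(Z) = ρ`, then
`(1 + ρ) · [P(X ∖ (Y∪Z)) + P(Y ∖ (X∪Z)) + P(Z ∖ (X∪Y))] ≤ 3ρ(1 − ρ)`.  Printed proof: Harris for the up-set
`X ∪ Y` against `Z` (and cyclically) gives, through inclusion–exclusion, the complement inequality
`3ρ s_0 ≥ (1−ρ) s_1`; together with `s_2 ≥ 0` and `s_1 + 2s_2 + 3s_3 = 3ρ` this is the bound.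
[cite: WilliamsKK2025, Theorem 3 (p. 2) and §3 (p. 3)] -/
theorem williams2025_thm3_mul {μ : Measure Ω} [IsProbabilityMeasure μ] (hμ : IsPositivelyAssociated μ)
    {X Y Z : Set Ω} (hX : IsUpperSet X) (hY : IsUpperSet Y) (hZ : IsUpperSet Z)
    (hXm : MeasurableSet X) (hYm : MeasurableSet Y) (hZm : MeasurableSet Z) {ρ : ℝ}
    (hXρ : μ.real X = ρ) (hYρ : μ.real Y = ρ) (hZρ : μ.real Z = ρ) :
    (1 + ρ) * (μ.real (X \ (Y ∪ Z)) + μ.real (Y \ (X ∪ Z)) + μ.real (Z \ (X ∪ Y))) ≤ 3 * ρ * (1 - ρ) := by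
  -- names for the pair and triple intersections
  set t := μ.real (X ∩ Y ∩ Z) with ht
  set pXY := μ.real (X ∩ Y) with hpXY
  set pXZ := μ.real (X ∩ Z) with hpXZ
  set pYZ := μ.real (Y ∩ Z) with hpYZ
  have hρ0 : 0 ≤ ρ := hXρ ▸ measureReal_nonneg
  -- inclusion–exclusion for the unions of two
  have uXY : μ.real (X ∪ Y) = 2 * ρ - pXY := by
    have := measureReal_union_add_inter (μ := μ) (s := X) hYm; linarith
  have uXZ : μ.real (X ∪ Z) = 2 * ρ - pXZ := by
    have := measureReal_union_add_inter (μ := μ) (s := X) hZm; linarith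
  have uYZ : μ.real (Y ∪ Z) = 2 * ρ - pYZ := by
    have := measureReal_union_add_inter (μ := μ) (s := Y) hZm; linarith
  -- `(X ∪ Y) ∩ Z = (X ∩ Z) ∪ (Y ∩ Z)`, whose intersection is `X ∩ Y ∩ Z`
  have iXY_Z : μ.real ((X ∪ Y) ∩ Z) = pXZ + pYZ - t := by
    have e : (X ∪ Y) ∩ Z = (X ∩ Z) ∪ (Y ∩ Z) := Set.union_inter_distrib_right X Y Z
    have h := measureReal_union_add_inter (μ := μ) (s := X ∩ Z) (t := Y ∩ Z) (hYm.inter hZm)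
    have e2 : X ∩ Z ∩ (Y ∩ Z) = X ∩ Y ∩ Z := by ext ω; simp only [mem_inter_iff]; tauto
    rw [e2] at h
    rw [e]; linarith
  have iXZ_Y : μ.real ((X ∪ Z) ∩ Y) = pXY + pYZ - t := by
    have e : (X ∪ Z) ∩ Y = (X ∩ Y) ∪ (Y ∩ Z) := by ext ω; simp only [mem_inter_iff, mem_union]; tauto
    have h := measureReal_union_add_inter (μ := μ) (s := X ∩ Y) (t := Y ∩ Z) (hYm.inter hZm)
    have e2 : X ∩ Y ∩ (Y ∩ Z) = X ∩ Y ∩ Z := by ext ω; simp only [mem_inter_iff]; tauto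
    rw [e2] at h
    rw [e]; linarith
  have iYZ_X : μ.real ((Y ∪ Z) ∩ X) = pXY + pXZ - t := by
    have e : (Y ∪ Z) ∩ X = (X ∩ Y) ∪ (X ∩ Z) := by ext ω; simp only [mem_inter_iff, mem_union]; tauto
    have h := measureReal_union_add_inter (μ := μ) (s := X ∩ Y) (t := X ∩ Z) (hXm.inter hZm)
    have e2 : X ∩ Y ∩ (X ∩ Z) = X ∩ Y ∩ Z := by ext ω; simp only [mem_inter_iff]; tauto
    rw [e2] at h
    rw [e]; linarith
  -- the three "exactly one" pieces: `P(X ∖ (Y ∪ Z)) = ρ − (pXY + pXZ − t)` etc.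
  have dX : μ.real (X \ (Y ∪ Z)) = ρ - (pXY + pXZ - t) := by
    have h := measureReal_inter_add_sdiff (μ := μ) (s := X) (t := Y ∪ Z) (hYm.union hZm)
    rw [Set.inter_comm, iYZ_X, hXρ] at h; linarith
  have dY : μ.real (Y \ (X ∪ Z)) = ρ - (pXY + pYZ - t) := by
    have h := measureReal_inter_add_sdiff (μ := μ) (s := Y) (t := X ∪ Z) (hXm.union hZm)
    rw [Set.inter_comm, iXZ_Y, hYρ] at h; linarith
  have dZ : μ.real (Z \ (X ∪ Y)) = ρ - (pXZ + pYZ - t) := by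
    have h := measureReal_inter_add_sdiff (μ := μ) (s := Z) (t := X ∪ Y) (hXm.union hYm)
    rw [Set.inter_comm, iXY_Z, hZρ] at h; linarith
  -- the union of all three
  have U3 : μ.real (X ∪ Y ∪ Z) = 3 * ρ - (pXY + pXZ + pYZ) + t := by
    have h := measureReal_union_add_inter (μ := μ) (s := X ∪ Y) (t := Z) hZm
    rw [iXY_Z, uXY, hZρ] at h; linarith
  have U1 : μ.real (X ∪ Y ∪ Z) ≤ 1 := measureReal_le_one
  -- Harris for the up-set `X ∪ Y` against `Z`, and cyclically ("the same argument for the complements")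
  have H1 := hμ.real (hX.union hY) hZ (hXm.union hYm) hZm
  have H2 := hμ.real (hX.union hZ) hY (hXm.union hZm) hYm
  have H3 := hμ.real (hY.union hZ) hX (hYm.union hZm) hXm
  rw [iXY_Z, uXY, hZρ] at H1
  rw [iXZ_Y, uXZ, hYρ] at H2
  rw [iYZ_X, uYZ, hXρ] at H3
  -- `s_2 ≥ 0`: the triple intersection is below each pair intersection
  have m1 : t ≤ pXY := measureReal_mono (Set.inter_subset_left) (measure_ne_top _ _)
  have m2 : t ≤ pXZ := measureReal_mono (fun ω h => ⟨h.1.1, h.2⟩) (measure_ne_top _ _)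
  have m3 : t ≤ pYZ := measureReal_mono (fun ω h => ⟨h.1.2, h.2⟩) (measure_ne_top _ _)
  rw [dX, dY, dZ]
  nlinarith [H1, H2, H3, m1, m2, m3, hρ0, U1, U3]

/-- **Williams 2025, Theorem 3**: for three increasing events of common probability `ρ` under a positively
associated probability measure, the probability of lying in EXACTLY ONE of them is at most
`3ρ(1 − ρ)/(1 + ρ)` ("`|S_1|/2^n ≤ 3ρ · (1−ρ)/(1+ρ)`" for up-sets of the uniform cube; the maximum of the bound
is `9 − 6√2 ≈ 0.515` at `ρ = √2 − 1`). [cite: WilliamsKK2025, Theorem 3 (p. 2)] -/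
theorem williams2025_thm3 {μ : Measure Ω} [IsProbabilityMeasure μ] (hμ : IsPositivelyAssociated μ)
    {X Y Z : Set Ω} (hX : IsUpperSet X) (hY : IsUpperSet Y) (hZ : IsUpperSet Z)
    (hXm : MeasurableSet X) (hYm : MeasurableSet Y) (hZm : MeasurableSet Z) {ρ : ℝ}
    (hXρ : μ.real X = ρ) (hYρ : μ.real Y = ρ) (hZρ : μ.real Z = ρ) :
    μ.real (X \ (Y ∪ Z)) + μ.real (Y \ (X ∪ Z)) + μ.real (Z \ (X ∪ Y)) ≤ 3 * ρ * (1 - ρ) / (1 + ρ) := by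
  have hρ0 : 0 ≤ ρ := hXρ ▸ measureReal_nonneg
  rw [le_div_iff₀ (by linarith), mul_comm]
  exact williams2025_thm3_mul hμ hX hY hZ hXm hYm hZm hXρ hYρ hZρ

/-! ### §2: Conjecture 2 is false for `n = 5`

The printed counterexample, `0`-indexed (`[5] = {1,…,5}` becomes `Fin 5 = {0,…,4}`), as finite set systems in
`Q_5 = Finset (Fin 5)` ordered by inclusion; every claim is a finite check closed by `decide`. -/

namespace Williams2025

/-- The points of `Q_n` lying in exactly one of `X, Y, Z`:
`S_1 = (X ∩ Yᶜ ∩ Zᶜ) ⊔ (Xᶜ ∩ Y ∩ Zᶜ) ⊔ (Xᶜ ∩ Yᶜ ∩ Z)`. [cite: WilliamsKK2025, p. 2 (definition of S_1)] -/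
def exactlyOne {α : Type*} [DecidableEq α] (X Y Z : Finset α) : Finset α :=
  X \ (Y ∪ Z) ∪ Y \ (X ∪ Z) ∪ Z \ (X ∪ Y)

/-- `X` = the sets containing `1` (here: containing `0`). [cite: WilliamsKK2025, §2 (p. 2)] -/
def X5 : Finset (Finset (Fin 5)) := Finset.univ.filter fun S => (0 : Fin 5) ∈ S

/-- `Y` = the sets containing `2` (here: containing `1`). [cite: WilliamsKK2025, §2 (p. 2)] -/
def Y5 : Finset (Finset (Fin 5)) := Finset.univ.filter fun S => (1 : Fin 5) ∈ S

/-- `Z` = the sets with at least three elements, with `{1,4,5}`, `{2,4,5}` removed and `{3,4}`, `{3,5}` added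
(here: `{0,3,4}`, `{1,3,4}` removed, `{2,3}`, `{2,4}` added). [cite: WilliamsKK2025, §2 (p. 2)] -/
def Z5 : Finset (Finset (Fin 5)) := Finset.univ.filter fun S =>
  (3 ≤ S.card ∧ S ≠ {0, 3, 4} ∧ S ≠ {1, 3, 4}) ∨ S = {2, 3} ∨ S = {2, 4}

/-- A set system given as a `Finset` is upward closed as soon as the finite check over `Finset.univ` passes
(plumbing for `decide`). [folklore] -/
private theorem isUpperSet_of_forall {F : Finset (Finset (Fin 5))}
    (h : ∀ a ∈ (Finset.univ : Finset (Finset (Fin 5))), ∀ b ∈ (Finset.univ : Finset (Finset (Fin 5))),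
      a ⊆ b → a ∈ F → b ∈ F) :
    IsUpperSet (F : Set (Finset (Fin 5))) := fun a b hab ha =>
  Finset.mem_coe.2 (h a (Finset.mem_univ a) b (Finset.mem_univ b) hab (Finset.mem_coe.1 ha))

/-- `X` is upward closed ("Clearly, `X, Y`, and `W` are upward closed"). [cite: WilliamsKK2025, §2 (p. 2)] -/
theorem isUpperSet_X5 : IsUpperSet (X5 : Set (Finset (Fin 5))) := isUpperSet_of_forall (by decide)

/-- `Y` is upward closed. [cite: WilliamsKK2025, §2 (p. 2)] -/
theorem isUpperSet_Y5 : IsUpperSet (Y5 : Set (Finset (Fin 5))) := isUpperSet_of_forall (by decide)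

/-- `Z` is upward closed ("The resulting set system `Z` is upward closed"). [cite: WilliamsKK2025, §2 (p. 2)] -/
theorem isUpperSet_Z5 : IsUpperSet (Z5 : Set (Finset (Fin 5))) := isUpperSet_of_forall (by decide)

/-- `X`, `Y`, `Z` have density `1/2`: `16` of the `32` points of `Q_5` each. [cite: WilliamsKK2025, §2 (p. 2)] -/
theorem card_X5_Y5_Z5 : X5.card = 16 ∧ Y5.card = 16 ∧ Z5.card = 16 := by decide

/-- `|S_1| = 5 + 5 + 3 = 13`. [cite: WilliamsKK2025, §2 (p. 2)] -/
theorem card_exactlyOne : (X5 \ (Y5 ∪ Z5)).card = 5 ∧ (Y5 \ (X5 ∪ Z5)).card = 5 ∧ (Z5 \ (X5 ∪ Y5)).card = 3 ∧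
    (exactlyOne X5 Y5 Z5).card = 13 := by
  decide

end Williams2025

/-- **Williams 2025, §2: Conjecture 2 is false for `n = 5`.**  There are upward closed set systems
`X, Y, Z ⊂ Q_5` of common density `ρ = 1/2` whose "exactly one" set `S_1` has `|S_1|/2^5 = 13/32 > 3/8 = 3ρ(1−ρ)²`
(the value for three independent up-sets); so `3ρ(1−ρ)²` is not an upper bound, while Theorem 3 gives `1/2` here.
[cite: WilliamsKK2025, Conjecture 2 and §2 (p. 2)] -/
theorem williams2025_conjecture2_false :
    ∃ X Y Z : Finset (Finset (Fin 5)), IsUpperSet (X : Set (Finset (Fin 5))) ∧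
      IsUpperSet (Y : Set (Finset (Fin 5))) ∧ IsUpperSet (Z : Set (Finset (Fin 5))) ∧
      (X.card : ℝ) / 2 ^ 5 = 1 / 2 ∧ (Y.card : ℝ) / 2 ^ 5 = 1 / 2 ∧ (Z.card : ℝ) / 2 ^ 5 = 1 / 2 ∧
      3 * (1 / 2 : ℝ) * (1 - 1 / 2) ^ 2 < ((Williams2025.exactlyOne X Y Z).card : ℝ) / 2 ^ 5 := by
  refine ⟨Williams2025.X5, Williams2025.Y5, Williams2025.Z5, Williams2025.isUpperSet_X5,
    Williams2025.isUpperSet_Y5, Williams2025.isUpperSet_Z5, ?_, ?_, ?_, ?_⟩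
  · rw [Williams2025.card_X5_Y5_Z5.1]; norm_num
  · rw [Williams2025.card_X5_Y5_Z5.2.1]; norm_num
  · rw [Williams2025.card_X5_Y5_Z5.2.2]; norm_num
  · rw [Williams2025.card_exactlyOne.2.2.2]; norm_num

end Literature.Probability.LatticeModels
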